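import Literature.Barriers.CriticalPhenomena.PlaquetteWalkHoleRootWoundCostNS
import HarnessLib

/-!
# Barrier catalogue (SAWScalingLimit): a GAP in an extreme row costs at least `7` — at limit cost `≤ 6` the top row and the
bottom row of a wound class-`B2a` walk are each visited in ONE run, with no sideways end («EXTREME-ROW GAP»)

First structural brick of the «RECTANGLE COEFFICIENT» classification (venture lane «pcv-sawmu», DESIGN-next b-engine-1 g23 §2.2):
the level-`5` wound limit sum `Λ₅` of the printed Yang–Baxter family [GlazmanManolescu2019, eq. (1)] at a `W`-normalised hole root
is a sum over the wound group members of limit cost exactly `5` (`PlaquetteWalkHoleRootWoundCost(NS)`: every member costs `≥ 5`;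
`cost = n_{u₁} + n_{u₂} + [z vertical]`). This file pins the EXTREME ROWS of the cost-`5` class-`B2a` members.

* ★★ `ΩG.four_top_turns_of_gap` / `ΩG.four_bottom_turns_of_gap`: if the topmost (bottommost) row `Y` of a wound class-`B2a` walk from
  the hole root is visited at indices `i < k` with an arc strictly between them in another row, row `Y` carries FOUR different
  `[corner]`/`[coCorner]` plaquettes — the entry and exit turns of the run through `i` (`YBWalk.exists_run_start/end`, the exit is
  forced because the run stops before `j`) and the entry and exit of the last run (`top_exit_or_end`) —, or three and a sideways end.
* `ΩG.two_top_turns` / `ΩG.two_bottom_turns` (the counting blocks of `five_le_cost_of_wound`, exported) and ★ `ΩG.cost_ge_of_two_rows`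
  (`A` isolated turns in one row, `B` in another, the two sideways-end exceptions excluding each other, COST PARITY ⇒ `cost ≥ A + B + 1`
  for `A + B` even).
* ★★★ `ΩG.seven_le_cost_of_top_gap` / `ΩG.seven_le_cost_of_bottom_gap`: a gap in an extreme row forces `cost ≥ 7`; hence
  ★★ `ΩG.top_row_interval_of_cost_le_six` / `ΩG.bottom_row_interval_of_cost_le_six`: at cost `≤ 6` the indices of the arcs in an
  extreme row form an INTERVAL (one run), and `ΩG.extreme_rows_intervals_of_cost_five`.
* `ΩG.fc_last_of_end_vertical` (the last plaquette of a walk ending on a vertical side of `r`: row of `r`, one column away),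
  ★★ `ΩG.not_end_in_top_row_of_cost_le_six` / `…bottom…`: at cost `≤ 6` the walk does NOT end sideways in an extreme row (the single
  run would consist of the first-hit arc and one more, against `Mv ≥ 3`); so both extreme rows carry full entry/exit pairs and
  ★★★ `ΩG.isolated_turns_of_cost_five`: a cost-`5` wound class-`B2a` walk has two isolated turns in the top row, two in the bottom
  row, AT MOST ONE strictly between, and NONE there when its end side is vertical.

Census side (b-engine-1 g23/g24, kit j271945 / j276221): the cost-`5` class-`B2a` members are the «rectangles» — one top run, one
bottom run, all with a slanted end `N`/`S`; the vertical-end members of level `5` are class-`B2b` extensions. The vertical-end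
exclusion for class `B2a` and the shape of the middle rows are NOT proved here.
[GlazmanManolescu2019 §1 Fig. 1, Lemma 2.1, Remark 2.2; Glazman 2015 Lemma 3.1 (proof, pp. 6–7); Courant–Robbins, even–odd rule]
-/

noncomputable section

namespace Literature.Probability.RandomPlanarGeometry.SAW.YangBaxter

open Real
open Literature.Barriers.CriticalPhenomena.PlaquetteWalk

open private fc_fh fc_ne fh_add_Mv three_le_Mv from Literature.Probability.RandomPlanarGeometry.YangBaxterSAWGeneralDomain

namespace ΩG

variable {D : Set Face} {w r : Face} {ω : ΩG D (w.side .W) r}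

/-- Four pairwise distinct elements make a finset of cardinality `4`. [folklore] -/
private theorem card_four {α : Type*} [DecidableEq α] {a b c d : α} (hab : a ≠ b) (hac : a ≠ c) (had : a ≠ d) (hbc : b ≠ c)
    (hbd : b ≠ d) (hcd : c ≠ d) : ({a, b, c, d} : Finset α).card = 4 := by
  rw [Finset.card_insert_of_notMem (by simp [hab, hac, had]), Finset.card_insert_of_notMem (by simp [hbc, hbd]),
    Finset.card_pair hcd]

/-- Three pairwise distinct elements make a finset of cardinality `3`. [folklore] -/
private theorem card_three {α : Type*} [DecidableEq α] {a b c : α} (hab : a ≠ b) (hac : a ≠ c) (hbc : b ≠ c) :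
    ({a, b, c} : Finset α).card = 3 := by
  rw [Finset.card_insert_of_notMem (by simp [hab, hac]), Finset.card_pair hbc]

/-- ★★ **A GAP IN THE TOP ROW GIVES FOUR ISOLATED TURNS THERE (or three and a sideways end).** Let `ω` be a wound class-`B2a` walk
from the hole root `w.side W` and let its topmost row `Y` be visited at indices `i < k` with an index `j` strictly between them whose
arc lies in another row. Then row `Y` carries four different `[corner]`/`[coCorner]` plaquettes of the walk — the entry and the exit
of the run through `i` and the entry and the exit of the last run — or three of them while the walk ends sideways in row `Y` (on a
vertical side of `r`, which then lies in row `Y`). [cite: GlazmanManolescu2019, §1, Fig. 1; Lemma 2.1]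
[cite: CourantRobbins1958, Ch. V Appendix §2 (the even–odd rule)] -/
theorem four_top_turns_of_gap (hh : holeFaceW w ∉ D) (hr : RootedFace D (w.side .W) r) (h : ω.IsB2a)
    (hA : ω.AJ hr h (toC (midPt (w.side .W))) ≠ 0) {Y : ℤ} (hY : ∀ j < ω.2.arcs.length, (ω.2.fc j).2 ≤ Y)
    {i j k : ℕ} (hij : i < j) (hjk : j < k) (hk : k < ω.2.arcs.length)
    (hi : (ω.2.fc i).2 = Y) (hj : (ω.2.fc j).2 ≠ Y) (hkY : (ω.2.fc k).2 = Y) :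
    ∃ T : Finset Face, (∀ f ∈ T, f ∈ facesL ω.2.mids ∧ (kindsL ω.2.mids f = [.corner] ∨ kindsL ω.2.mids f = [.coCorner])) ∧
      (∀ f ∈ T, f.2 = Y) ∧ (4 ≤ T.card ∨ (3 ≤ T.card ∧ (ω.1 = .W ∨ ω.1 = .E) ∧ r.2 = Y)) := by
  classical
  have hlen : 0 < ω.2.arcs.length := by omega
  have hiL : i < ω.2.arcs.length := by omega
  have h0 : ω.2.fc 0 = w := fc_zero_eq_root w hh ω.2 hlen
  -- the top row of `top_exit_or_end` is `Y`
  obtain ⟨Y', hYw', hY', i₀, i₁, -, hi₀2, hrow₀, -, -, -, hi₁, hrow₁, hmax, halt⟩ := top_exit_or_end hh hr h hA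
  have hYY : Y' = Y := le_antisymm (by have := hY i₀ (by omega); omega) (by have := hY' i hiL; omega)
  subst hYY
  have hYw : w.2 < Y' := by omega
  have hne := forall_top_ne_N hh hr h hY hYw
  have hsv : ∀ a, a < ω.2.arcs.length → (ω.2.fc a).2 = Y' → ∀ b < ω.2.arcs.length, ω.2.fc b = ω.2.fc a → b = a :=
    fun a ha hrow b hb he => (top_single_visit hh hr h hY hYw ha hb hrow he.symm).symm
  -- an arc of row `Y'` entering vertically is an isolated turn `S → W/E`
  have entry_turn : ∀ a, a < ω.2.arcs.length → (ω.2.fc a).2 = Y' → (ω.2.sIn a = .S ∨ ω.2.sIn a = .N) →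
      ω.2.sIn a = .S ∧ (ω.2.fc a ∈ facesL ω.2.mids ∧
        (kindsL ω.2.mids (ω.2.fc a) = [.corner] ∨ kindsL ω.2.mids (ω.2.fc a) = [.coCorner])) := by
    intro a ha hrow hSN
    have hS : ω.2.sIn a = .S := by
      rcases hSN with e | e
      · exact e
      · exact absurd e (hne a ha hrow).1
    have hsd := ω.2.sIn_ne_sOut ha
    rw [hS] at hsd
    have hWE : ω.2.sOut a = .W ∨ ω.2.sOut a = .E := by
      cases hs : ω.2.sOut a
      · exact Or.inl rfl
      · exact Or.inr rfl
      · exact absurd hs.symm hsd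
      · exact absurd hs (hne a ha hrow).2
    exact ⟨hS, isolated_turn ha (hsv a ha hrow) (by rw [hS]; exact YBWalk.arcKind_ne_straight_of_S_WE (Or.inl rfl) hWE)⟩
  -- the run through `i`: start `j₀ ≤ i` (entry turn) and end `j₁ < j` (exit turn through `S`)
  obtain ⟨j₀, hj₀1, hj₀i, hrun₀, -, hSN₀, -⟩ := ω.2.exists_run_start hiL (by rw [h0, hi]; omega)
  obtain ⟨j₁, hij₁, hj₁L, hrun₁, hend₁, -⟩ := ω.2.exists_run_end hiL
  have hj₁j : j₁ < j := by
    by_contra hle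
    exact hj ((hrun₁ j (by omega) (by omega)).trans hi)
  have hrowj₀ : (ω.2.fc j₀).2 = Y' := (hrun₀ j₀ le_rfl hj₀i).trans hi
  have hrowj₁ : (ω.2.fc j₁).2 = Y' := (hrun₁ j₁ hij₁ le_rfl).trans hi
  obtain ⟨hS₀, hP₀⟩ := entry_turn j₀ (by omega) hrowj₀ hSN₀
  have hexit₁ : ω.2.sOut j₁ = .S ∧ (ω.2.sIn j₁ = .W ∨ ω.2.sIn j₁ = .E) := by
    rcases hend₁ with hlast | ⟨hlt, hnext, -⟩
    · omega
    · exact ω.2.sOut_eq_S_of_last_in_row hY hlt (by omega) hrowj₁ (fun e => hnext (e.trans hi.symm))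
  have hP₁ := isolated_turn hj₁L (hsv j₁ hj₁L hrowj₁)
    (by rw [hexit₁.1]; exact YBWalk.arcKind_ne_straight_of_WE_S hexit₁.2 (Or.inl rfl))
  have hj₀₁ : j₀ ≠ j₁ := by
    intro e
    rcases hexit₁.2 with e' | e' <;> rw [← e, hS₀] at e' <;> exact absurd e' (by decide)
  -- the run through `k`: start `j₂ > j` (entry turn); `k ≤ i₁`, the last index in row `Y'`
  obtain ⟨j₂, hj₂1, hj₂k, hrun₂, -, hSN₂, -⟩ := ω.2.exists_run_start hk (by rw [h0, hkY]; omega)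
  have hjj₂ : j < j₂ := by
    by_contra hle
    exact hj ((hrun₂ j (by omega) (by omega)).trans hkY)
  have hrowj₂ : (ω.2.fc j₂).2 = Y' := (hrun₂ j₂ le_rfl hj₂k).trans hkY
  obtain ⟨hS₂, hP₂⟩ := entry_turn j₂ (by omega) hrowj₂ hSN₂
  have hki₁ : k ≤ i₁ := by
    by_contra hlt
    exact hmax k (by omega) hk hkY
  -- distinct plaquettes (singly visited row, distinct indices)
  have hf₀₁ : ω.2.fc j₀ ≠ ω.2.fc j₁ := fun e => hj₀₁ ((hsv j₁ hj₁L hrowj₁ j₀ (by omega) e))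
  have hf₀₂ : ω.2.fc j₀ ≠ ω.2.fc j₂ := fun e => absurd (hsv j₂ (by omega) hrowj₂ j₀ (by omega) e) (by omega)
  have hf₁₂ : ω.2.fc j₁ ≠ ω.2.fc j₂ := fun e => absurd (hsv j₂ (by omega) hrowj₂ j₁ hj₁L e) (by omega)
  rcases halt with ⟨hS₃, hWE₃, -, -⟩ | ⟨hend, hz, hrY⟩
  · -- exit turn at `i₁`, different from the entry `j₂`
    have hP₃ := isolated_turn hi₁ (hsv i₁ hi₁ hrow₁)
      (by rw [hS₃]; exact YBWalk.arcKind_ne_straight_of_WE_S hWE₃ (Or.inl rfl))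
    have hj₂₃ : j₂ ≠ i₁ := by
      intro e
      rcases hWE₃ with e' | e' <;> rw [← e, hS₂] at e' <;> exact absurd e' (by decide)
    have hf₀₃ : ω.2.fc j₀ ≠ ω.2.fc i₁ := fun e => absurd (hsv i₁ hi₁ hrow₁ j₀ (by omega) e) (by omega)
    have hf₁₃ : ω.2.fc j₁ ≠ ω.2.fc i₁ := fun e => absurd (hsv i₁ hi₁ hrow₁ j₁ hj₁L e) (by omega)
    have hf₂₃ : ω.2.fc j₂ ≠ ω.2.fc i₁ := fun e => hj₂₃ (hsv i₁ hi₁ hrow₁ j₂ (by omega) e)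
    refine ⟨{ω.2.fc j₀, ω.2.fc j₁, ω.2.fc j₂, ω.2.fc i₁}, ?_, ?_, Or.inl (by rw [card_four hf₀₁ hf₀₂ hf₀₃ hf₁₂ hf₁₃ hf₂₃])⟩
    · intro f hf
      simp only [Finset.mem_insert, Finset.mem_singleton] at hf
      rcases hf with rfl | rfl | rfl | rfl
      · exact hP₀
      · exact hP₁
      · exact hP₂
      · exact hP₃
    · intro f hf
      simp only [Finset.mem_insert, Finset.mem_singleton] at hf
      rcases hf with rfl | rfl | rfl | rfl
      · exact hrowj₀
      · exact hrowj₁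
      · exact hrowj₂
      · exact hrow₁
  · refine ⟨{ω.2.fc j₀, ω.2.fc j₁, ω.2.fc j₂}, ?_, ?_, Or.inr ⟨by rw [card_three hf₀₁ hf₀₂ hf₁₂], hz, hrY⟩⟩
    · intro f hf
      simp only [Finset.mem_insert, Finset.mem_singleton] at hf
      rcases hf with rfl | rfl | rfl
      · exact hP₀
      · exact hP₁
      · exact hP₂
    · intro f hf
      simp only [Finset.mem_insert, Finset.mem_singleton] at hf
      rcases hf with rfl | rfl | rfl
      · exact hrowj₀
      · exact hrowj₁
      · exact hrowj₂

/-- The bottom row of a wound class-`B2a` walk carries two `[corner]`/`[coCorner]` plaquettes, or one and a sideways end in that row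
(the counting block of `five_le_cost_of_wound`, exported). [cite: GlazmanManolescu2019, §1, Fig. 1; Lemma 2.1]
[cite: CourantRobbins1958, Ch. V Appendix §2 (the even–odd rule)] -/
theorem two_bottom_turns (hh : holeFaceW w ∉ D) (hr : RootedFace D (w.side .W) r) (h : ω.IsB2a)
    (hA : ω.AJ hr h (toC (midPt (w.side .W))) ≠ 0) :
    ∃ Y' : ℤ, Y' ≤ w.2 - 1 ∧ (∀ j < ω.2.arcs.length, Y' ≤ (ω.2.fc j).2) ∧ ∃ T : Finset Face,
      (∀ f ∈ T, f ∈ facesL ω.2.mids ∧ (kindsL ω.2.mids f = [.corner] ∨ kindsL ω.2.mids f = [.coCorner])) ∧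
      (∀ f ∈ T, f.2 = Y') ∧ (2 ≤ T.card ∨ (1 ≤ T.card ∧ (ω.1 = .W ∨ ω.1 = .E) ∧ r.2 = Y')) := by
  classical
  obtain ⟨Y', hYw', hY', j₀, j₁, -, hj₀2, hrow₀', hN₀, hWE₀', -, hj₁, hrow₁', -, halt'⟩ := bottom_exit_or_end hh hr h hA
  have hsv' : ∀ i, i < ω.2.arcs.length → (ω.2.fc i).2 = Y' → ∀ j < ω.2.arcs.length, ω.2.fc j = ω.2.fc i → j = i :=
    fun i hi hrow j hj he => (bottom_single_visit hh hr h hY' (by omega) hi hj hrow he.symm).symm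
  have hj₀ : j₀ < ω.2.arcs.length := by omega
  have hQ₀ := isolated_turn hj₀ (hsv' j₀ hj₀ hrow₀')
    (by rw [hN₀]; exact YBWalk.arcKind_ne_straight_of_S_WE (Or.inr rfl) hWE₀')
  refine ⟨Y', hYw', hY', ?_⟩
  rcases halt' with ⟨hN₁, hWE₁, -, hfne⟩ | ⟨-, hz, hrY⟩
  · have hQ₁ := isolated_turn hj₁ (hsv' j₁ hj₁ hrow₁')
      (by rw [hN₁]; exact YBWalk.arcKind_ne_straight_of_WE_S hWE₁ (Or.inr rfl))
    refine ⟨{ω.2.fc j₀, ω.2.fc j₁}, ?_, ?_, Or.inl (by rw [Finset.card_pair hfne])⟩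
    · intro f hf
      rcases Finset.mem_insert.1 hf with rfl | hf
      · exact hQ₀
      · rw [Finset.mem_singleton.1 hf]; exact hQ₁
    · intro f hf
      rcases Finset.mem_insert.1 hf with rfl | hf
      · exact hrow₀'
      · rw [Finset.mem_singleton.1 hf]; exact hrow₁'
  · exact ⟨{ω.2.fc j₀}, fun f hf => by rw [Finset.mem_singleton.1 hf]; exact hQ₀,
      fun f hf => by rw [Finset.mem_singleton.1 hf]; exact hrow₀', Or.inr ⟨by simp, hz, hrY⟩⟩

/-- The top-row twin: two `[corner]`/`[coCorner]` plaquettes in the top row, or one and a sideways end there.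
[cite: GlazmanManolescu2019, §1, Fig. 1; Lemma 2.1] [cite: CourantRobbins1958, Ch. V Appendix §2 (the even–odd rule)] -/
theorem two_top_turns (hh : holeFaceW w ∉ D) (hr : RootedFace D (w.side .W) r) (h : ω.IsB2a)
    (hA : ω.AJ hr h (toC (midPt (w.side .W))) ≠ 0) :
    ∃ Y : ℤ, w.2 + 1 ≤ Y ∧ (∀ j < ω.2.arcs.length, (ω.2.fc j).2 ≤ Y) ∧ ∃ T : Finset Face,
      (∀ f ∈ T, f ∈ facesL ω.2.mids ∧ (kindsL ω.2.mids f = [.corner] ∨ kindsL ω.2.mids f = [.coCorner])) ∧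
      (∀ f ∈ T, f.2 = Y) ∧ (2 ≤ T.card ∨ (1 ≤ T.card ∧ (ω.1 = .W ∨ ω.1 = .E) ∧ r.2 = Y)) := by
  classical
  obtain ⟨Y, hYw, hY, i₀, i₁, -, hi₀2, hrow₀, hS₀, hWE₀, -, hi₁, hrow₁, -, halt⟩ := top_exit_or_end hh hr h hA
  have hsv : ∀ i, i < ω.2.arcs.length → (ω.2.fc i).2 = Y → ∀ j < ω.2.arcs.length, ω.2.fc j = ω.2.fc i → j = i :=
    fun i hi hrow j hj he => (top_single_visit hh hr h hY (by omega) hi hj hrow he.symm).symm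
  have hi₀ : i₀ < ω.2.arcs.length := by omega
  have hP₀ := isolated_turn hi₀ (hsv i₀ hi₀ hrow₀)
    (by rw [hS₀]; exact YBWalk.arcKind_ne_straight_of_S_WE (Or.inl rfl) hWE₀)
  refine ⟨Y, hYw, hY, ?_⟩
  rcases halt with ⟨hS₁, hWE₁, -, hfne⟩ | ⟨-, hz, hrY⟩
  · have hP₁ := isolated_turn hi₁ (hsv i₁ hi₁ hrow₁)
      (by rw [hS₁]; exact YBWalk.arcKind_ne_straight_of_WE_S hWE₁ (Or.inl rfl))
    refine ⟨{ω.2.fc i₀, ω.2.fc i₁}, ?_, ?_, Or.inl (by rw [Finset.card_pair hfne])⟩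
    · intro f hf
      rcases Finset.mem_insert.1 hf with rfl | hf
      · exact hP₀
      · rw [Finset.mem_singleton.1 hf]; exact hP₁
    · intro f hf
      rcases Finset.mem_insert.1 hf with rfl | hf
      · exact hrow₀
      · rw [Finset.mem_singleton.1 hf]; exact hrow₁
  · exact ⟨{ω.2.fc i₀}, fun f hf => by rw [Finset.mem_singleton.1 hf]; exact hP₀,
      fun f hf => by rw [Finset.mem_singleton.1 hf]; exact hrow₀, Or.inr ⟨by simp, hz, hrY⟩⟩

/-- ★ **THE COUNTING STEP**: `[corner]`/`[coCorner]` plaquettes in two different rows, `A` of them in one (or `A − 1` with a sideways end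
there) and `B` in the other (or `B − 1` with a sideways end there), force `cost ≥ A + B + 1` — COST PARITY rounds the vertical-end
case up. [cite: GlazmanManolescu2019, §1, Fig. 1 and eq. (1); Remark 2.2] -/
theorem cost_ge_of_two_rows {Y₁ Y₂ : ℤ} (hne : Y₁ ≠ Y₂) {A B : ℕ}
    (T₁ T₂ : Finset Face)
    (hT₁ : ∀ f ∈ T₁, f ∈ facesL ω.2.mids ∧ (kindsL ω.2.mids f = [.corner] ∨ kindsL ω.2.mids f = [.coCorner]))
    (hT₂ : ∀ f ∈ T₂, f ∈ facesL ω.2.mids ∧ (kindsL ω.2.mids f = [.corner] ∨ kindsL ω.2.mids f = [.coCorner]))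
    (hr₁ : ∀ f ∈ T₁, f.2 = Y₁) (hr₂ : ∀ f ∈ T₂, f.2 = Y₂)
    (hc₁ : A ≤ T₁.card ∨ (A ≤ T₁.card + 1 ∧ (ω.1 = .W ∨ ω.1 = .E) ∧ r.2 = Y₁))
    (hc₂ : B ≤ T₂.card ∨ (B ≤ T₂.card + 1 ∧ (ω.1 = .W ∨ ω.1 = .E) ∧ r.2 = Y₂)) (hAB : (A + B) % 2 = 0) :
    A + B + 1 ≤ cost (slotOfSide ω.1) ω.2.mids := by
  classical
  have hcost : cost (slotOfSide ω.1) ω.2.mids =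
      cfgCount ω.2.mids [.corner] + cfgCount ω.2.mids [.coCorner] + (1 - slotDeg (slotOfSide ω.1)) := rfl
  have hdisj : Disjoint T₁ T₂ := by
    rw [Finset.disjoint_left]
    intro f hf₁ hf₂
    have e1 := hr₁ f hf₁; have e2 := hr₂ f hf₂; exact hne (e1.symm.trans e2)
  have hcard : T₁.card + T₂.card ≤ cfgCount ω.2.mids [.corner] + cfgCount ω.2.mids [.coCorner] := by
    rw [← Finset.card_union_of_disjoint hdisj]
    exact YBWalk.card_le_cfgCount_add ω.2.mids _ fun f hf => by
      rcases Finset.mem_union.1 hf with hf | hf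
      · exact hT₁ f hf
      · exact hT₂ f hf
  -- the two sideways-end exceptions exclude each other (`r` lies in one row)
  have hsum : A + B ≤ cfgCount ω.2.mids [.corner] + cfgCount ω.2.mids [.coCorner] ∨
      (A + B ≤ cfgCount ω.2.mids [.corner] + cfgCount ω.2.mids [.coCorner] + 1 ∧ (ω.1 = .W ∨ ω.1 = .E)) := by
    rcases hc₁ with h1 | ⟨h1, hz1, hr1⟩ <;> rcases hc₂ with h2 | ⟨h2, hz2, hr2⟩
    · left; omega
    · right; exact ⟨by omega, hz2⟩
    · right; exact ⟨by omega, hz1⟩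
    · exact absurd (hr1.symm.trans hr2) hne
  -- COST PARITY
  have hpar := cfgCount_corner_add_coCorner_mod_two ω.2
  obtain ⟨hvW, -, -, -⟩ := vertB_side w
  obtain ⟨hrW, hrE, hrS, hrN⟩ := vertB_side r
  rw [hvW] at hpar
  have hds : ∀ s : Side, (slotDeg (slotOfSide s) = 0 ∧ vertB (r.side s) = true ∧ (s = .W ∨ s = .E)) ∨
      (slotDeg (slotOfSide s) = 1 ∧ vertB (r.side s) = false ∧ ¬(s = .W ∨ s = .E)) := by
    intro s
    cases s
    · exact Or.inl ⟨by decide, hrW, Or.inl rfl⟩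
    · exact Or.inl ⟨by decide, hrE, Or.inr rfl⟩
    · exact Or.inr ⟨by decide, hrS, by decide⟩
    · exact Or.inr ⟨by decide, hrN, by decide⟩
  rw [hcost]
  rcases hds ω.1 with ⟨hd, hv, -⟩ | ⟨hd, hv, hz⟩
  · have hp : (cfgCount ω.2.mids [.corner] + cfgCount ω.2.mids [.coCorner]) % 2 = 0 := hpar.trans (by rw [hv]; simp)
    rw [hd]
    rcases hsum with hs | ⟨hs, -⟩ <;> omega
  · have hp : (cfgCount ω.2.mids [.corner] + cfgCount ω.2.mids [.coCorner]) % 2 = 1 := hpar.trans (by rw [hv]; simp)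
    rw [hd]
    rcases hsum with hs | ⟨hs, hz'⟩
    · omega
    · exact absurd hz' hz

/-- ★★★ **A GAP IN THE TOP ROW COSTS AT LEAST `7`.** If the topmost row of a wound class-`B2a` walk from the hole root `w.side W` is
visited at indices `i < k` with an arc strictly between them in another row, then `cost ≥ 7` in the `Z → ∞` limit model: four isolated
turns in the top row (or three and a sideways end) and two in the bottom row (or one and a sideways end — not both ends), rounded up
by COST PARITY. Hence **at cost `5` the top row is visited in ONE run.** [cite: GlazmanManolescu2019, §1, Fig. 1; Lemma 2.1; Remark 2.2]
[cite: Glazman2015WeightedSAW, Lemma 3.1 (proof, pp. 6–7)] [cite: CourantRobbins1958, Ch. V Appendix §2 (the even–odd rule)] -/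
theorem seven_le_cost_of_top_gap (hh : holeFaceW w ∉ D) (hr : RootedFace D (w.side .W) r) (h : ω.IsB2a)
    (hA : ω.AJ hr h (toC (midPt (w.side .W))) ≠ 0) {Y : ℤ} (hY : ∀ j < ω.2.arcs.length, (ω.2.fc j).2 ≤ Y)
    {i j k : ℕ} (hij : i < j) (hjk : j < k) (hk : k < ω.2.arcs.length)
    (hi : (ω.2.fc i).2 = Y) (hj : (ω.2.fc j).2 ≠ Y) (hkY : (ω.2.fc k).2 = Y) :
    7 ≤ cost (slotOfSide ω.1) ω.2.mids := by
  classical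
  obtain ⟨T₁, hT₁, hr₁, hc₁⟩ := four_top_turns_of_gap hh hr h hA hY hij hjk hk hi hj hkY
  obtain ⟨Y', hYw', -, T₂, hT₂, hr₂, hc₂⟩ := two_bottom_turns hh hr h hA
  have hYw : w.2 < Y := by
    have hlen : 0 < ω.2.arcs.length := by omega
    have h0 : ω.2.fc 0 = w := fc_zero_eq_root w hh ω.2 hlen
    obtain ⟨Y₀, hY₀w, hY₀, i₀, -, hi₀2, hrow₀, -⟩ := exists_top_entry_corner hh hr h hA
    have := hY i₀ (by omega); omega
  have hne : Y ≠ Y' := by omega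
  exact cost_ge_of_two_rows hne T₁ T₂ hT₁ hT₂ hr₁ hr₂
    (hc₁.elim (fun h1 => Or.inl h1) (fun h1 => Or.inr ⟨by omega, h1.2.1, h1.2.2⟩))
    (hc₂.elim (fun h2 => Or.inl h2) (fun h2 => Or.inr ⟨by omega, h2.2.1, h2.2.2⟩)) (by norm_num)

/-- ★★ **AT COST AT MOST `6` THE TOP ROW IS ONE RUN**: the indices whose arcs lie in the topmost row form an interval.
[cite: GlazmanManolescu2019, §1, Fig. 1; Lemma 2.1] -/
theorem top_row_interval_of_cost_le_six (hh : holeFaceW w ∉ D) (hr : RootedFace D (w.side .W) r) (h : ω.IsB2a)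
    (hA : ω.AJ hr h (toC (midPt (w.side .W))) ≠ 0) (hc : cost (slotOfSide ω.1) ω.2.mids ≤ 6) {Y : ℤ}
    (hY : ∀ j < ω.2.arcs.length, (ω.2.fc j).2 ≤ Y) {i j k : ℕ} (hij : i ≤ j) (hjk : j ≤ k) (hk : k < ω.2.arcs.length)
    (hi : (ω.2.fc i).2 = Y) (hkY : (ω.2.fc k).2 = Y) : (ω.2.fc j).2 = Y := by
  by_contra hj
  have hij' : i < j := lt_of_le_of_ne hij (by rintro rfl; exact hj hi)
  have hjk' : j < k := lt_of_le_of_ne hjk (by rintro rfl; exact hj hkY)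
  have := seven_le_cost_of_top_gap hh hr h hA hY hij' hjk' hk hi hj hkY
  omega

/-! ## The bottom-row twins -/

/-- ★★ **A GAP IN THE BOTTOM ROW GIVES FOUR ISOLATED TURNS THERE (or three and a sideways end)** — the twin of
`four_top_turns_of_gap` with `N`/`S` exchanged. [cite: GlazmanManolescu2019, §1, Fig. 1; Lemma 2.1]
[cite: CourantRobbins1958, Ch. V Appendix §2 (the even–odd rule)] -/
theorem four_bottom_turns_of_gap (hh : holeFaceW w ∉ D) (hr : RootedFace D (w.side .W) r) (h : ω.IsB2a)
    (hA : ω.AJ hr h (toC (midPt (w.side .W))) ≠ 0) {Y : ℤ} (hY : ∀ j < ω.2.arcs.length, Y ≤ (ω.2.fc j).2)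
    {i j k : ℕ} (hij : i < j) (hjk : j < k) (hk : k < ω.2.arcs.length)
    (hi : (ω.2.fc i).2 = Y) (hj : (ω.2.fc j).2 ≠ Y) (hkY : (ω.2.fc k).2 = Y) :
    ∃ T : Finset Face, (∀ f ∈ T, f ∈ facesL ω.2.mids ∧ (kindsL ω.2.mids f = [.corner] ∨ kindsL ω.2.mids f = [.coCorner])) ∧
      (∀ f ∈ T, f.2 = Y) ∧ (4 ≤ T.card ∨ (3 ≤ T.card ∧ (ω.1 = .W ∨ ω.1 = .E) ∧ r.2 = Y)) := by
  classical
  have hlen : 0 < ω.2.arcs.length := by omega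
  have hiL : i < ω.2.arcs.length := by omega
  have h0 : ω.2.fc 0 = w := fc_zero_eq_root w hh ω.2 hlen
  obtain ⟨Y', hYw', hY', i₀, i₁, -, hi₀2, hrow₀, -, -, -, hi₁, hrow₁, hmax, halt⟩ := bottom_exit_or_end hh hr h hA
  have hYY : Y' = Y := le_antisymm (by have := hY' i hiL; omega) (by have := hY i₀ (by omega); omega)
  subst hYY
  have hYw : Y' < w.2 := by omega
  have hne := forall_bottom_ne_S hh hr h hY hYw
  have hsv : ∀ a, a < ω.2.arcs.length → (ω.2.fc a).2 = Y' → ∀ b < ω.2.arcs.length, ω.2.fc b = ω.2.fc a → b = a :=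
    fun a ha hrow b hb he => (bottom_single_visit hh hr h hY hYw ha hb hrow he.symm).symm
  have entry_turn : ∀ a, a < ω.2.arcs.length → (ω.2.fc a).2 = Y' → (ω.2.sIn a = .S ∨ ω.2.sIn a = .N) →
      ω.2.sIn a = .N ∧ (ω.2.fc a ∈ facesL ω.2.mids ∧
        (kindsL ω.2.mids (ω.2.fc a) = [.corner] ∨ kindsL ω.2.mids (ω.2.fc a) = [.coCorner])) := by
    intro a ha hrow hSN
    have hN : ω.2.sIn a = .N := by
      rcases hSN with e | e
      · exact absurd e (hne a ha hrow).1
      · exact e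
    have hsd := ω.2.sIn_ne_sOut ha
    rw [hN] at hsd
    have hWE : ω.2.sOut a = .W ∨ ω.2.sOut a = .E := by
      cases hs : ω.2.sOut a
      · exact Or.inl rfl
      · exact Or.inr rfl
      · exact absurd hs (hne a ha hrow).2
      · exact absurd hs.symm hsd
    exact ⟨hN, isolated_turn ha (hsv a ha hrow) (by rw [hN]; exact YBWalk.arcKind_ne_straight_of_S_WE (Or.inr rfl) hWE)⟩
  obtain ⟨j₀, hj₀1, hj₀i, hrun₀, -, hSN₀, -⟩ := ω.2.exists_run_start hiL (by rw [h0, hi]; omega)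
  obtain ⟨j₁, hij₁, hj₁L, hrun₁, hend₁, -⟩ := ω.2.exists_run_end hiL
  have hj₁j : j₁ < j := by
    by_contra hle
    exact hj ((hrun₁ j (by omega) (by omega)).trans hi)
  have hrowj₀ : (ω.2.fc j₀).2 = Y' := (hrun₀ j₀ le_rfl hj₀i).trans hi
  have hrowj₁ : (ω.2.fc j₁).2 = Y' := (hrun₁ j₁ hij₁ le_rfl).trans hi
  obtain ⟨hN₀, hP₀⟩ := entry_turn j₀ (by omega) hrowj₀ hSN₀
  have hexit₁ : ω.2.sOut j₁ = .N ∧ (ω.2.sIn j₁ = .W ∨ ω.2.sIn j₁ = .E) := by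
    rcases hend₁ with hlast | ⟨hlt, hnext, -⟩
    · omega
    · exact ω.2.sOut_eq_N_of_last_in_row hY hlt (by omega) hrowj₁ (fun e => hnext (e.trans hi.symm))
  have hP₁ := isolated_turn hj₁L (hsv j₁ hj₁L hrowj₁)
    (by rw [hexit₁.1]; exact YBWalk.arcKind_ne_straight_of_WE_S hexit₁.2 (Or.inr rfl))
  have hj₀₁ : j₀ ≠ j₁ := by
    intro e
    rcases hexit₁.2 with e' | e' <;> rw [← e, hN₀] at e' <;> exact absurd e' (by decide)
  obtain ⟨j₂, hj₂1, hj₂k, hrun₂, -, hSN₂, -⟩ := ω.2.exists_run_start hk (by rw [h0, hkY]; omega)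
  have hjj₂ : j < j₂ := by
    by_contra hle
    exact hj ((hrun₂ j (by omega) (by omega)).trans hkY)
  have hrowj₂ : (ω.2.fc j₂).2 = Y' := (hrun₂ j₂ le_rfl hj₂k).trans hkY
  obtain ⟨hN₂, hP₂⟩ := entry_turn j₂ (by omega) hrowj₂ hSN₂
  have hki₁ : k ≤ i₁ := by
    by_contra hlt
    exact hmax k (by omega) hk hkY
  have hf₀₁ : ω.2.fc j₀ ≠ ω.2.fc j₁ := fun e => hj₀₁ ((hsv j₁ hj₁L hrowj₁ j₀ (by omega) e))
  have hf₀₂ : ω.2.fc j₀ ≠ ω.2.fc j₂ := fun e => absurd (hsv j₂ (by omega) hrowj₂ j₀ (by omega) e) (by omega)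
  have hf₁₂ : ω.2.fc j₁ ≠ ω.2.fc j₂ := fun e => absurd (hsv j₂ (by omega) hrowj₂ j₁ hj₁L e) (by omega)
  rcases halt with ⟨hN₃, hWE₃, -, -⟩ | ⟨hend, hz, hrY⟩
  · have hP₃ := isolated_turn hi₁ (hsv i₁ hi₁ hrow₁)
      (by rw [hN₃]; exact YBWalk.arcKind_ne_straight_of_WE_S hWE₃ (Or.inr rfl))
    have hj₂₃ : j₂ ≠ i₁ := by
      intro e
      rcases hWE₃ with e' | e' <;> rw [← e, hN₂] at e' <;> exact absurd e' (by decide)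
    have hf₀₃ : ω.2.fc j₀ ≠ ω.2.fc i₁ := fun e => absurd (hsv i₁ hi₁ hrow₁ j₀ (by omega) e) (by omega)
    have hf₁₃ : ω.2.fc j₁ ≠ ω.2.fc i₁ := fun e => absurd (hsv i₁ hi₁ hrow₁ j₁ hj₁L e) (by omega)
    have hf₂₃ : ω.2.fc j₂ ≠ ω.2.fc i₁ := fun e => hj₂₃ (hsv i₁ hi₁ hrow₁ j₂ (by omega) e)
    refine ⟨{ω.2.fc j₀, ω.2.fc j₁, ω.2.fc j₂, ω.2.fc i₁}, ?_, ?_, Or.inl (by rw [card_four hf₀₁ hf₀₂ hf₀₃ hf₁₂ hf₁₃ hf₂₃])⟩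
    · intro f hf
      simp only [Finset.mem_insert, Finset.mem_singleton] at hf
      rcases hf with rfl | rfl | rfl | rfl
      · exact hP₀
      · exact hP₁
      · exact hP₂
      · exact hP₃
    · intro f hf
      simp only [Finset.mem_insert, Finset.mem_singleton] at hf
      rcases hf with rfl | rfl | rfl | rfl
      · exact hrowj₀
      · exact hrowj₁
      · exact hrowj₂
      · exact hrow₁
  · refine ⟨{ω.2.fc j₀, ω.2.fc j₁, ω.2.fc j₂}, ?_, ?_, Or.inr ⟨by rw [card_three hf₀₁ hf₀₂ hf₁₂], hz, hrY⟩⟩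
    · intro f hf
      simp only [Finset.mem_insert, Finset.mem_singleton] at hf
      rcases hf with rfl | rfl | rfl
      · exact hP₀
      · exact hP₁
      · exact hP₂
    · intro f hf
      simp only [Finset.mem_insert, Finset.mem_singleton] at hf
      rcases hf with rfl | rfl | rfl
      · exact hrowj₀
      · exact hrowj₁
      · exact hrowj₂

/-- ★★★ **A GAP IN THE BOTTOM ROW COSTS AT LEAST `7`** (twin of `seven_le_cost_of_top_gap`). [cite: GlazmanManolescu2019, §1, Fig. 1; Lemma 2.1; Remark 2.2]
[cite: Glazman2015WeightedSAW, Lemma 3.1 (proof, pp. 6–7)] [cite: CourantRobbins1958, Ch. V Appendix §2 (the even–odd rule)] -/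
theorem seven_le_cost_of_bottom_gap (hh : holeFaceW w ∉ D) (hr : RootedFace D (w.side .W) r) (h : ω.IsB2a)
    (hA : ω.AJ hr h (toC (midPt (w.side .W))) ≠ 0) {Y : ℤ} (hY : ∀ j < ω.2.arcs.length, Y ≤ (ω.2.fc j).2)
    {i j k : ℕ} (hij : i < j) (hjk : j < k) (hk : k < ω.2.arcs.length)
    (hi : (ω.2.fc i).2 = Y) (hj : (ω.2.fc j).2 ≠ Y) (hkY : (ω.2.fc k).2 = Y) :
    7 ≤ cost (slotOfSide ω.1) ω.2.mids := by
  classical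
  obtain ⟨T₁, hT₁, hr₁, hc₁⟩ := four_bottom_turns_of_gap hh hr h hA hY hij hjk hk hi hj hkY
  obtain ⟨Y', hYw', -, T₂, hT₂, hr₂, hc₂⟩ := two_top_turns hh hr h hA
  have hYw : Y < w.2 := by
    obtain ⟨Y₀, hY₀w, hY₀, i₀, -, hi₀2, hrow₀, -⟩ := exists_bottom_entry_corner hh hr h hA
    have := hY i₀ (by omega); omega
  have hne : Y ≠ Y' := by omega
  exact cost_ge_of_two_rows hne T₁ T₂ hT₁ hT₂ hr₁ hr₂
    (hc₁.elim (fun h1 => Or.inl h1) (fun h1 => Or.inr ⟨by omega, h1.2.1, h1.2.2⟩))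
    (hc₂.elim (fun h2 => Or.inl h2) (fun h2 => Or.inr ⟨by omega, h2.2.1, h2.2.2⟩)) (by norm_num)

/-- ★★ **AT COST AT MOST `6` THE BOTTOM ROW IS ONE RUN**: the indices whose arcs lie in the bottommost row form an interval.
[cite: GlazmanManolescu2019, §1, Fig. 1; Lemma 2.1] -/
theorem bottom_row_interval_of_cost_le_six (hh : holeFaceW w ∉ D) (hr : RootedFace D (w.side .W) r) (h : ω.IsB2a)
    (hA : ω.AJ hr h (toC (midPt (w.side .W))) ≠ 0) (hc : cost (slotOfSide ω.1) ω.2.mids ≤ 6) {Y : ℤ}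
    (hY : ∀ j < ω.2.arcs.length, Y ≤ (ω.2.fc j).2) {i j k : ℕ} (hij : i ≤ j) (hjk : j ≤ k) (hk : k < ω.2.arcs.length)
    (hi : (ω.2.fc i).2 = Y) (hkY : (ω.2.fc k).2 = Y) : (ω.2.fc j).2 = Y := by
  by_contra hj
  have hij' : i < j := lt_of_le_of_ne hij (by rintro rfl; exact hj hi)
  have hjk' : j < k := lt_of_le_of_ne hjk (by rintro rfl; exact hj hkY)
  have := seven_le_cost_of_bottom_gap hh hr h hA hY hij' hjk' hk hi hj hkY
  omega

/-- ★★ **THE WOUND WALKS OF COST `5` VISIT EACH EXTREME ROW IN ONE RUN.** For a wound class-`B2a` walk from a `W`-normalised hole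
root of limit cost `5` (the minimal wound level of `PlaquetteWalkHoleRootWoundCost`), both the topmost and the bottommost row are
visited in a single run of consecutive arcs: the level-`5` («rectangle») members have exactly one top run and one bottom run.
[cite: GlazmanManolescu2019, §1, Fig. 1; Lemma 2.1; Remark 2.2] [cite: Glazman2015WeightedSAW, Lemma 3.1 (proof, pp. 6–7)] -/
theorem extreme_rows_intervals_of_cost_five (hh : holeFaceW w ∉ D) (hr : RootedFace D (w.side .W) r) (h : ω.IsB2a)
    (hA : ω.AJ hr h (toC (midPt (w.side .W))) ≠ 0) (hc : cost (slotOfSide ω.1) ω.2.mids = 5) :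
    (∀ {Y : ℤ}, (∀ j < ω.2.arcs.length, (ω.2.fc j).2 ≤ Y) → ∀ {i j k : ℕ}, i ≤ j → j ≤ k → k < ω.2.arcs.length →
        (ω.2.fc i).2 = Y → (ω.2.fc k).2 = Y → (ω.2.fc j).2 = Y) ∧
      (∀ {Y : ℤ}, (∀ j < ω.2.arcs.length, Y ≤ (ω.2.fc j).2) → ∀ {i j k : ℕ}, i ≤ j → j ≤ k → k < ω.2.arcs.length →
        (ω.2.fc i).2 = Y → (ω.2.fc k).2 = Y → (ω.2.fc j).2 = Y) :=
  ⟨fun hY _ _ _ hij hjk hk hi hkY => top_row_interval_of_cost_le_six hh hr h hA (by omega) hY hij hjk hk hi hkY,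
    fun hY _ _ _ hij hjk hk hi hkY => bottom_row_interval_of_cost_le_six hh hr h hA (by omega) hY hij hjk hk hi hkY⟩

/-! ## No sideways end in an extreme row at cost `≤ 6`; the isolated turns of a cost-`5` walk -/

/-- The last plaquette of a class-`B2a` walk ending on a VERTICAL side of `r` lies in the row of `r`, one column east or west of `r`.
[cite: GlazmanManolescu2019, §1, Fig. 1; Lemma 2.1 (the classes of walks at a rhombus)] -/
theorem fc_last_of_end_vertical (hr : RootedFace D (w.side .W) r) (h : ω.IsB2a) (hz : ω.1 = .W ∨ ω.1 = .E) :
    (ω.2.fc (ω.2.arcs.length - 1)).2 = r.2 ∧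
      ((ω.2.fc (ω.2.arcs.length - 1)).1 = r.1 + 1 ∨ (ω.2.fc (ω.2.arcs.length - 1)).1 + 1 = r.1) ∧
      (ω.2.sOut (ω.2.arcs.length - 1) = .W ∨ ω.2.sOut (ω.2.arcs.length - 1) = .E) := by
  have hF := ω.fh_lt h
  have hlen : 0 < ω.2.arcs.length := by omega
  set k := ω.2.arcs.length - 1 with hk
  have hkL : k < ω.2.arcs.length := by omega
  obtain ⟨-, hout⟩ := ω.2.side_sIn_eq_nth hkL
  rw [show k + 1 = ω.2.arcs.length by omega, ω.2.nth_length] at hout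
  have hFk : ω.2.firstHitG < k := by
    have := three_le_Mv hr h; have := fh_add_Mv h; unfold ΩG.Mv at *; omega
  have hlastne : ω.2.fc k ≠ r := fc_ne ω hr h hFk hkL
  -- `r.side ω.1` is vertical, so the exit side of the last arc is `W` or `E`
  have hvert : ∀ u, ω.1 = u → (u = .W ∨ u = .E) → ∃ x y, r.side u = .vert x y := by
    intro u _ hu
    rcases hu with rfl | rfl
    · exact ⟨r.1, r.2, rfl⟩
    · exact ⟨r.1 + 1, r.2, rfl⟩
  obtain ⟨x₀, y₀, hv⟩ := hvert ω.1 rfl hz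
  rcases hfc : ω.2.fc k with ⟨x, y⟩
  rw [hfc] at hout hlastne
  cases hs : ω.2.sOut k
  · rw [hs] at hout
    have e : r.side ω.1 = .vert x y := by rw [← hout]; rfl
    rcases eq_of_side_eq_vert e with ⟨h2, -⟩ | ⟨h2, -⟩
    · exact absurd h2.symm hlastne
    · rw [h2]; exact ⟨rfl, Or.inl (by simp), Or.inl rfl⟩
  · rw [hs] at hout
    have e : r.side ω.1 = .vert (x + 1) y := by rw [← hout]; rfl
    rcases eq_of_side_eq_vert e with ⟨h2, -⟩ | ⟨h2, -⟩
    · rw [h2]; exact ⟨rfl, Or.inr (by simp), Or.inr rfl⟩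
    · exact absurd (h2.trans (by simp)).symm hlastne
  · rw [hs] at hout
    have e : r.side ω.1 = .slant x y := by rw [← hout]; rfl
    rw [e] at hv; exact absurd hv (by simp)
  · rw [hs] at hout
    have e : r.side ω.1 = .slant x (y + 1) := by rw [← hout]; rfl
    rw [e] at hv; exact absurd hv (by simp)

/-- ★★ **NO SIDEWAYS END IN THE TOP ROW AT COST `≤ 6`.** If a wound class-`B2a` walk of limit cost `≤ 6` ended on a vertical side of an
`r` lying in its topmost row, the single top run (`top_row_interval_of_cost_le_six`) would contain the first-hit arc in `r` and end
one column away from `r`, i.e. consist of two arcs — but the excursion of a class-`B2a` walk has at least three arcs.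
[cite: GlazmanManolescu2019, §1, Fig. 1; Lemma 2.1] [cite: Glazman2015WeightedSAW, Lemma 3.1 (proof, pp. 6–7)] -/
theorem not_end_in_top_row_of_cost_le_six (hh : holeFaceW w ∉ D) (hr : RootedFace D (w.side .W) r) (h : ω.IsB2a)
    (hA : ω.AJ hr h (toC (midPt (w.side .W))) ≠ 0) (hc : cost (slotOfSide ω.1) ω.2.mids ≤ 6) {Y : ℤ}
    (hY : ∀ j < ω.2.arcs.length, (ω.2.fc j).2 ≤ Y) : ¬((ω.1 = .W ∨ ω.1 = .E) ∧ r.2 = Y) := by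
  rintro ⟨hz, hrY⟩
  have hF := ω.fh_lt h
  obtain ⟨hfcF, -, -⟩ := fc_fh ω hr h
  obtain ⟨hrow, hcol, -⟩ := fc_last_of_end_vertical hr h hz
  have h3 := three_le_Mv hr h
  have hFM := fh_add_Mv h
  unfold ΩG.Mv at h3 hFM
  -- every arc from the first hit on lies in row `Y`
  have hall : ∀ m, ω.2.firstHitG ≤ m → m < ω.2.arcs.length → (ω.2.fc m).2 = Y := fun m h1 h2 =>
    top_row_interval_of_cost_le_six hh hr h hA hc hY (i := ω.2.firstHitG) (j := m) (k := ω.2.arcs.length - 1) h1 (by omega)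
      (by omega) (by rw [hfcF, hrY]) (by rw [hrow, hrY])
  -- the run from the first hit reaches the last arc with monotone columns
  obtain ⟨j₁, hFj₁, hj₁L, -, hend, hdir⟩ := ω.2.exists_run_end hF
  have hj₁ : j₁ = ω.2.arcs.length - 1 := by
    rcases hend with e | ⟨hlt, hne, -⟩
    · omega
    · exact absurd ((hall (j₁ + 1) (by omega) hlt).trans ((hall _ le_rfl hF)).symm) hne
  rw [hj₁, hfcF] at hdir
  rcases hdir with ⟨-, hx⟩ | ⟨-, hx⟩ <;> rcases hcol with hc' | hc' <;> omega

/-- ★★ **NO SIDEWAYS END IN THE BOTTOM ROW AT COST `≤ 6`** (twin). [cite: GlazmanManolescu2019, §1, Fig. 1; Lemma 2.1]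
[cite: Glazman2015WeightedSAW, Lemma 3.1 (proof, pp. 6–7)] -/
theorem not_end_in_bottom_row_of_cost_le_six (hh : holeFaceW w ∉ D) (hr : RootedFace D (w.side .W) r) (h : ω.IsB2a)
    (hA : ω.AJ hr h (toC (midPt (w.side .W))) ≠ 0) (hc : cost (slotOfSide ω.1) ω.2.mids ≤ 6) {Y : ℤ}
    (hY : ∀ j < ω.2.arcs.length, Y ≤ (ω.2.fc j).2) : ¬((ω.1 = .W ∨ ω.1 = .E) ∧ r.2 = Y) := by
  rintro ⟨hz, hrY⟩
  have hF := ω.fh_lt h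
  obtain ⟨hfcF, -, -⟩ := fc_fh ω hr h
  obtain ⟨hrow, hcol, -⟩ := fc_last_of_end_vertical hr h hz
  have h3 := three_le_Mv hr h
  have hFM := fh_add_Mv h
  unfold ΩG.Mv at h3 hFM
  have hall : ∀ m, ω.2.firstHitG ≤ m → m < ω.2.arcs.length → (ω.2.fc m).2 = Y := fun m h1 h2 =>
    bottom_row_interval_of_cost_le_six hh hr h hA hc hY (i := ω.2.firstHitG) (j := m) (k := ω.2.arcs.length - 1) h1 (by omega)
      (by omega) (by rw [hfcF, hrY]) (by rw [hrow, hrY])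
  obtain ⟨j₁, hFj₁, hj₁L, -, hend, hdir⟩ := ω.2.exists_run_end hF
  have hj₁ : j₁ = ω.2.arcs.length - 1 := by
    rcases hend with e | ⟨hlt, hne, -⟩
    · omega
    · exact absurd ((hall (j₁ + 1) (by omega) hlt).trans ((hall _ le_rfl hF)).symm) hne
  rw [hj₁, hfcF] at hdir
  rcases hdir with ⟨-, hx⟩ | ⟨-, hx⟩ <;> rcases hcol with hc' | hc' <;> omega

/-- ★★★ **THE ISOLATED TURNS OF A COST-`5` WOUND WALK**: (at least) two `[corner]`/`[coCorner]` plaquettes in the top row and two in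
the bottom row — full entry/exit pairs, no sideways end —, hence AT MOST ONE strictly between the extreme rows, and NONE when the end
side is vertical (`cost = n_{u₁} + n_{u₂} + [z vertical] = 5`). [cite: GlazmanManolescu2019, §1, Fig. 1 and eq. (1); Lemma 2.1; Remark 2.2]
[cite: Glazman2015WeightedSAW, Lemma 3.1 (proof, pp. 6–7)] [cite: CourantRobbins1958, Ch. V Appendix §2 (the even–odd rule)] -/
theorem isolated_turns_of_cost_five (hh : holeFaceW w ∉ D) (hr : RootedFace D (w.side .W) r) (h : ω.IsB2a)
    (hA : ω.AJ hr h (toC (midPt (w.side .W))) ≠ 0) (hc : cost (slotOfSide ω.1) ω.2.mids = 5) :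
    ∃ Y Y' : ℤ, Y' < w.2 ∧ w.2 < Y ∧ (∀ j < ω.2.arcs.length, (ω.2.fc j).2 ≤ Y) ∧ (∀ j < ω.2.arcs.length, Y' ≤ (ω.2.fc j).2) ∧
      ∃ T₁ T₂ : Finset Face,
        (∀ f ∈ T₁, f ∈ facesL ω.2.mids ∧ (kindsL ω.2.mids f = [.corner] ∨ kindsL ω.2.mids f = [.coCorner])) ∧
        (∀ f ∈ T₂, f ∈ facesL ω.2.mids ∧ (kindsL ω.2.mids f = [.corner] ∨ kindsL ω.2.mids f = [.coCorner])) ∧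
        (∀ f ∈ T₁, f.2 = Y) ∧ (∀ f ∈ T₂, f.2 = Y') ∧ 2 ≤ T₁.card ∧ 2 ≤ T₂.card ∧
        ∀ T₃ : Finset Face,
          (∀ f ∈ T₃, f ∈ facesL ω.2.mids ∧ (kindsL ω.2.mids f = [.corner] ∨ kindsL ω.2.mids f = [.coCorner])) →
          (∀ f ∈ T₃, Y' < f.2 ∧ f.2 < Y) → T₃.card + (1 - slotDeg (slotOfSide ω.1)) ≤ 1 := by
  classical
  have hcost : cost (slotOfSide ω.1) ω.2.mids =
      cfgCount ω.2.mids [.corner] + cfgCount ω.2.mids [.coCorner] + (1 - slotDeg (slotOfSide ω.1)) := rfl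
  obtain ⟨Y, hYw, hY, T₁, hT₁, hr₁, hc₁⟩ := two_top_turns hh hr h hA
  obtain ⟨Y', hYw', hY', T₂, hT₂, hr₂, hc₂⟩ := two_bottom_turns hh hr h hA
  have hnot₁ := not_end_in_top_row_of_cost_le_six hh hr h hA (by omega) hY
  have hnot₂ := not_end_in_bottom_row_of_cost_le_six hh hr h hA (by omega) hY'
  have hc₁' : 2 ≤ T₁.card := hc₁.elim id (fun h1 => absurd ⟨h1.2.1, h1.2.2⟩ hnot₁)
  have hc₂' : 2 ≤ T₂.card := hc₂.elim id (fun h2 => absurd ⟨h2.2.1, h2.2.2⟩ hnot₂)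
  -- the count with any middle finset `T₃`
  have key : ∀ T₃ : Finset Face,
      (∀ f ∈ T₃, f ∈ facesL ω.2.mids ∧ (kindsL ω.2.mids f = [.corner] ∨ kindsL ω.2.mids f = [.coCorner])) →
      (∀ f ∈ T₃, Y' < f.2 ∧ f.2 < Y) →
        T₁.card + T₂.card + T₃.card ≤ cfgCount ω.2.mids [.corner] + cfgCount ω.2.mids [.coCorner] := by
    intro T₃ hT₃ hr₃
    have h12 : Disjoint T₁ T₂ := by
      rw [Finset.disjoint_left]; intro f hf₁ hf₂; have e1 := hr₁ f hf₁; have e2 := hr₂ f hf₂; omega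
    have h13 : Disjoint (T₁ ∪ T₂) T₃ := by
      rw [Finset.disjoint_left]; intro f hf hf₃
      have e3 := hr₃ f hf₃
      rcases Finset.mem_union.1 hf with hf | hf
      · have e1 := hr₁ f hf; omega
      · have e2 := hr₂ f hf; omega
    rw [← Finset.card_union_of_disjoint h12, ← Finset.card_union_of_disjoint h13]
    exact YBWalk.card_le_cfgCount_add ω.2.mids _ fun f hf => by
      rcases Finset.mem_union.1 hf with hf | hf
      · rcases Finset.mem_union.1 hf with hf | hf
        · exact hT₁ f hf
        · exact hT₂ f hf
      · exact hT₃ f hf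
  have hs : slotDeg (slotOfSide ω.1) ≤ 1 := by unfold slotDeg; split_ifs <;> omega
  rw [hcost] at hc
  refine ⟨Y, Y', by omega, by omega, hY, hY', T₁, T₂, hT₁, hT₂, hr₁, hr₂, hc₁', hc₂', fun T₃ hT₃ hr₃ => ?_⟩
  have := key T₃ hT₃ hr₃
  omega

end ΩG

end Literature.Probability.RandomPlanarGeometry.SAW.YangBaxter
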